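import Summits.ResolutionOfSingularities.ResolutionOfSingularities.Theorems.FrobeniusClosingSteerHevLeafMaxDropSplit
import Summits.ResolutionOfSingularities.ResolutionOfSingularities.Theorems.FrobeniusClosingSteerSteeredExit
import Summits.ResolutionOfSingularities.ResolutionOfSingularities.Theorems.FrobeniusClosingSteerWords07SteeredLeaves
import HarnessLib

/-!
# Crux `Steer` (stmt-ResolutionOfSingularities-16345), chain W4.1 — **(MAX-D)ᴵ holds**: the DROP half of the even MAX branch of the stripping tail is a
# TREE THEOREM (`maxDrop_holds`), assembled from the order-induction binder and run vocabulary

OURS (campaign `res-hironaka`, rung L ★L-G4, slot W4.1; seat res-D-lib-2 g10 = FILE K of res-L0-w41-plan-1 RULING 252(c); words + member lemma =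
res-L0-w41-strat-2's `…HevLeafMaxDropSplit` (MEMO §23, `MAX/EvenMaxDropSplit_signature.lean` e4e144cf63bbb82c); run plumbing = the (I2)/(I4)/(I5) items of the
booked `shNR_holds` scratch 14457cd2c0c98e5c). Candidates, not facts; nothing here is a statement of H. Hironaka's manuscript [Hironaka2017] (status: under
review). AI-written; AI review is weaker than expert review.

THE ASSEMBLY (`maxDrop_holds : DropSplit.StrippingTailSwitchingEvenInfMaxDropConclIndTwoN`). Intro the 31 binders; the wild-point binder gives point steps
beyond every stage, so the binary-residue binder yields a LATE POINT STEP `j` with `BinaryResiduePointStepAt … (2e) j`, whose EXACTNESS clause says no cleaner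
of `s j ^ 2` reaches `𝔪_j^(2e+1)`. The member `R j` is regular (`Words.steeredMembersRegular_holds`), `s j` generates the torsor of `t` over it
(`SteeredExit.mem_closure_insert_of_steps`), and `R j` is the local ring at the centre of a finitely generated model `A₁ ⊇ A₀` (`SteeredExit.exists_model_of_tower`);
strat-2's member lemma `DropSplit.concl_of_exact_member_of_startReach` at `d = 2e + 1` with `hstart` := the DROP conjunct «the START radicand reaches `2e + 1`»
yields `Concl O A₀ t`. Net effect on the book (RULING 252(c)): [hEv-∞]ᴵ = (MAX)ᴵ = CLOSED-MODULO (MAX-ND)ᴵ (glue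
`DropSplit.strippingTailSwitchingEvenInfMaxConclIndTwoN_of_drop_of_noDrop`).
-/

-- `Summit.<S>.<S>.…` duplicates the summit name by design (single-problem summit).
set_option linter.dupNamespace false

open IsLocalRing
open Literature.AlgebraicGeometry.Resolution
open Summit.ResolutionOfSingularities.ResolutionOfSingularities.Theorems.SwitchingDichotomy.Words
open Summit.ResolutionOfSingularities.ResolutionOfSingularities.Theorems.SteerRankThinness (Concl HasProperCoarsening)
open Summit.ResolutionOfSingularities.ResolutionOfSingularities.Theorems.SwitchingDichotomy.ArithReduction
open Summit.ResolutionOfSingularities.ResolutionOfSingularities.Theorems.SwitchingDichotomy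
open Summit.ResolutionOfSingularities.ResolutionOfSingularities.Theorems.SwitchingDichotomy.Hull (GenAt)

namespace Summit.ResolutionOfSingularities.ResolutionOfSingularities.Theorems.SwitchingDichotomy.HevLeaf

namespace DropSplit

variable {K : Type} [Field K]

/-- A LATE point step carrying the binary residue of degree `2e`: from point steps beyond every stage (the wild-point binder) and the eventual
binary-residue binder (pure logic). OURS. [folklore] -/
theorem exists_late_binary_point (R : ℕ → Subring K) (P : (i : ℕ) → Ideal (R i)) (s : ℕ → K) (p e i₀ : ℕ)
    (hb : ∀ i, i₀ ≤ i → IsPointStep R P i → BinaryResiduePointStepAt R P s p (2 * e) i)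
    (hwild : ∀ i₀ : ℕ, ∃ i, i₀ ≤ i ∧ IsPointStep R P i ∧
      ∀ hs : s i ^ p ∈ R i, ¬ HasIsolatedSingularity (RadicandRing (R i) p ⟨s i ^ p, hs⟩)) :
    ∃ j, i₀ ≤ j ∧ BinaryResiduePointStepAt R P s p (2 * e) j := by
  obtain ⟨j, hj, hpt, -⟩ := hwild i₀
  exact ⟨j, hj, hb j hj hpt⟩

/-- **(MAX-D)ᴵ HOLDS.** See the module docstring. OURS. [folklore] -/
theorem maxDrop_holds : StrippingTailSwitchingEvenInfMaxDropConclIndTwoN := by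
  intro p hp2 k K _ _ _ _ _ O A₀ h₀ t core hrk R P s hR0 hN hrun hnd hhigh h2 hinf hwild hsw hev hbin hsat hsing hmax hbelow
  subst hp2
  classical
  obtain ⟨i₀, e, -, hb, hstart⟩ := hbin
  obtain ⟨j, -, hbr⟩ := exists_late_binary_point R P s 2 e i₀ hb hwild
  -- ### the run's clauses
  have hs0 : s 0 = t := hrun.1
  haveI hRloc : ∀ i, IsLocalRing (R i) := fun i => (hrun.2 i).1
  have hsp : ∀ i, s i ^ 2 ∈ R i := fun i => (hrun.2 i).2.1
  have hbl : ∀ i, IsLocalBlowupAlong O (R i) (P i) (R (i + 1)) := fun i => (hrun.2 i).2.2.2.1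
  have hst : ∀ i, ∃ x g : K, ((∃ hx : x ∈ R i, (⟨x, hx⟩ : R i) ∈ P i) ∧ x ≠ 0 ∧
      ∀ y : R i, y ∈ P i → O.valuation (y : K) ≤ O.valuation x) ∧ g ∈ R i ∧ s i = x * s (i + 1) + g :=
    fun i => (hrun.2 i).2.2.2.2
  -- ### the exactness clause at `j`: no cleaner of `s j ^ 2` reaches `2e + 1`
  obtain ⟨-, _, hsj, -, -, -, -, -, hexact⟩ := hbr
  -- ### (I2) the member is regular
  have hI2 : IsRegularLocalRing (R j) :=
    steeredMembersRegular_holds 2 Nat.prime_two 4 le_rfl k K O A₀ h₀ t core R P s j hR0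
      ⟨hs0, fun i _ => hsp i, fun i _ => hrun.2 i⟩
  -- ### (I4) `s j` generates the torsor of `t` over `R j`
  have hI4 : GenAt (R j) 2 t (s j) := by
    refine ⟨hsp j, SteeredExit.mem_closure_insert_of_steps hs0 (fun i _ => (hbl i).isLocalBlowup.le) fun i _ => ?_⟩
    obtain ⟨x, g, ⟨⟨hx, -⟩, -, -⟩, hg, he⟩ := hst i
    exact ⟨x, g, hx, hg, he⟩
  -- ### (I5) a finitely generated model of the member
  obtain ⟨hfg, -⟩ := id core
  obtain ⟨A₁, h₁, hA₀A₁, hfg₁, hRj⟩ :=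
    SteeredExit.exists_model_of_tower O A₀ h₀ hfg hR0 (N := j) fun i _ => (hbl i).isLocalBlowup
  -- ### the member lemma at `d = 2e + 1`
  exact concl_of_exact_member_of_startReach O A₀ h₀ t core hbelow (R j) A₁ h₁ hA₀A₁ hfg₁ hRj hI2 hI4 (d := 2 * e + 1)
    (fun g => hexact g) hstart

end DropSplit

end Summit.ResolutionOfSingularities.ResolutionOfSingularities.Theorems.SwitchingDichotomy.HevLeaf
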